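import Literature.AlgebraicGeometry.Modules.ProperFlatH0KernelRepr
import Literature.Algebra.Module.TwoTermComplexBaseChange
import Mathlib.AlgebraicGeometry.Fiber
import Mathlib.AlgebraicGeometry.Properties
import HarnessLib

/-!
# Upper semicontinuity of `h⁰` in a proper flat family (Mumford, *Abelian Varieties*, §5 Cor. 1; EGA III 7.7.5;
# Görtz–Wedhorn II, Thm. 23.139 (2))

Topic `Literature/AlgebraicGeometry/Morphisms`; theorems only (no definition, no named fact, no instance, no notation, no
`sorry`).  Cell hodgecm-mathlib, F-DAG F-6 (I) brick U2 (census `B-provers/B-p15/g12/CENSUS-F6I-GeomConnectedOpen.B-p15g12.md`,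
B-plan1 (g15) GO 06:20:19Z 2026-08-30).  HC_CM is proved only modulo the 7 printed citations until rung 0 closes; nothing here
bears on a summit statement.

Setting: `g : X ⟶ B` proper and flat, `B` AFFINE and locally noetherian, `G` finite locally free on `X` (`Scheme.{0}`, the
universe of the (h2) chain).  For a field-valued point `y : Spec K ⟶ B` and a cartesian square `Z = X ×_B Spec K`
(`IsPullback fst snd g y`), the FIBRE RANK `h⁰(y) := dim Γ(Z, fst^*G)` is read as
`Module.finrank Γ(Spec K, 𝒪) (SecMod (fst^*G) snd♯ ⊤)` (the sections as a module over `Γ(Spec K, 𝒪) ≅ K` through `snd♯`,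
★ `Modules/ModuleCechComplex.SecMod`); Mathlib's fibre `g.fiber b → Spec κ(b)` is the case `y = B.fromSpecResidueField b`.

* §1 (algebra) `finrank_ker_baseChange_eq_of_isScalarTower` — for `d : K⁰ → K¹` of finite projective `A`-modules and a tower
  `A → κ → L` of fields, `dim_L ker(d ⊗ L) = dim_κ ker(d ⊗ κ)` (★ `finrank_ker_baseChange_eq_finrank_tensor` twice + Mathlib
  `finrank_baseChange`);
* §2 (points) `appTop_fieldPoint_eq_zero_iff`, `mem_asIdeal_toSpecΓ_iff`, **`ker_fieldPoint_eq_asIdeal_toSpecΓ`** — the kernel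
  of `Γ(B, 𝒪) → Γ(Spec K, 𝒪)` along a field point `y` is the prime `B.toSpecΓ (y pt)` of `Spec Γ(B, 𝒪)` (any scheme `B`);
* §3 **`finrank_secMod_fieldPoint_eq_finrank_ker`** — with `d : K⁰ → K¹` the two-term complex of ★ U1
  `Modules/ProperFlatH0KernelRepr` (hypothesis `hd` = its conclusion): `h⁰(y) = dim_{κ(𝔮)} ker(d ⊗ κ(𝔮))` at
  `𝔮 = B.toSpecΓ (y pt)`; hence `h⁰` depends only on the image point (`finrank_secMod_fieldPoint_eq_of_base_eq`);
* §4 **UPPER SEMICONTINUITY**: `isClosed_setOf_le_finrank_secMod_fieldPoint` / `isOpen_setOf_finrank_secMod_fieldPoint_lt`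
  (`{b | n ≤ h⁰}` closed, `{b | h⁰ < n}` open, `h⁰` read on ALL field points over `b` and all cartesian squares) and the
  Mathlib-fibre forms `isClosed_setOf_le_finrank_secMod_fiber` / `isOpen_setOf_finrank_secMod_fiber_lt` — ★
  `Algebra/Module/TwoTermComplexBaseChange.isClosed_setOf_le_finrank_ker_baseChange` pulled back along the continuous
  `B.toSpecΓ : B → Spec Γ(B, 𝒪)`.

## References
* D. Mumford, *Abelian Varieties*, TIFR Studies in Mathematics 5 (1970), §5, Cor. 1 and Cor. 2 (pp. 50–51). [MumfordAV1970]
* A. Grothendieck, EGA III₂ (Publ. Math. IHÉS 17, 1963), Thm. 7.7.5 (I), 7.7.6. [EGAIII2]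
* U. Görtz, T. Wedhorn, *Algebraic Geometry II: Cohomology of Schemes* (2023), Thm. 23.139 (2), Cor. 23.135 (p. 355). [GortzWedhorn2023]
* R. Hartshorne, *Algebraic Geometry*, GTM 52 (1977), III Thm. 12.8 (p. 288). [Hartshorne1977]
-/

noncomputable section

set_option backward.isDefEq.respectTransparency false

open CategoryTheory CategoryTheory.Limits Opposite TopologicalSpace AlgebraicGeometry TensorProduct Module

universe u

namespace Literature.AlgebraicGeometry.Morphisms

open Literature.AlgebraicGeometry.Modules Literature.AlgebraicGeometry.Motives Literature.Algebra.Module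

/-! ## §1 The fibre rank of `ker(d ⊗ ·)` is invariant along a tower of fields -/

section Tower

variable {A : Type u} [CommRing A] {K0 K1 : Type u} [AddCommGroup K0] [Module A K0] [AddCommGroup K1] [Module A K1]
  [Module.Finite A K0] [Projective A K0] [Module.Finite A K1] [Projective A K1]

/-- **`dim_L ker(d ⊗ L) = dim_κ ker(d ⊗ κ)` along a tower of fields `A → κ → L`**, for `d : K⁰ → K¹` of finite projective
`A`-modules: both sides are `dim (· ⊗_A Q)` for the representing module `Q = (K⁰)^∨ ⧸ im d^∨` (★
`finrank_ker_baseChange_eq_finrank_tensor`), and `L ⊗_A Q = L ⊗_κ (κ ⊗_A Q)`. [cite: MumfordAV1970, §5 Cor. 2 (p. 50)]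
[cite: EGAIII2, 7.7.6] -/
theorem finrank_ker_baseChange_eq_of_isScalarTower (d : K0 →ₗ[A] K1) (κ L : Type u) [Field κ] [Field L]
    [Algebra A κ] [Algebra A L] [Algebra κ L] [IsScalarTower A κ L] :
    finrank L (LinearMap.ker (d.baseChange L)) = finrank κ (LinearMap.ker (d.baseChange κ)) := by
  rw [finrank_ker_baseChange_eq_finrank_tensor d L, finrank_ker_baseChange_eq_finrank_tensor d κ,
    ← (TensorProduct.AlgebraTensorModule.cancelBaseChange A κ L L (Dual A K0 ⧸ LinearMap.range d.dualMap)).finrank_eq,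
    Module.finrank_baseChange]

end Tower

/-! ## §2 Field-valued points and the primes of `Spec Γ(B, 𝒪_B)` -/

section Points

variable (B : Scheme.{u}) {K : Type u} [Field K] (y : Spec (.of K) ⟶ B)

/-- Along a field point `y : Spec K → B`, a global function `f` pulls back to `0` iff the image point misses `D(f)`
(`Spec K` is one reduced point). [cite: EGAIII2, 7.7.5 (I)] -/
theorem appTop_fieldPoint_eq_zero_iff (pt : Spec (.of K)) (f : Γ(B, ⊤)) :
    y.appTop f = 0 ↔ y.base pt ∉ B.basicOpen f := by
  rw [← basicOpen_eq_bot_iff (X := Spec (.of K)), ← Scheme.preimage_basicOpen_top]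
  constructor
  · intro h hmem
    have : pt ∈ y ⁻¹ᵁ B.basicOpen f := hmem
    rw [h] at this
    exact this
  · intro h
    ext x
    simp only [Opens.coe_bot, Set.mem_empty_iff_false, iff_false]
    intro hx
    have hx' : y.base x ∈ B.basicOpen f := hx
    rw [Subsingleton.elim (α := PrimeSpectrum K) x pt] at hx'
    exact h hx'

/-- The `appLE ⊤ ⊤` form of the pull-back of a global function (the ring map of ★ `Modules/AffineTestObjects`) agrees with
`appTop`. [cite: GortzWedhorn2023, Cor. 23.135 (p. 355)] -/
theorem appLE_top_top_apply {X Y : Scheme.{u}} (f : X ⟶ Y) (r : Γ(Y, ⊤)) : f.appLE ⊤ ⊤ le_top r = f.appTop r := by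
  change X.presheaf.map (homOfLE le_top).op (f.appTop r) = f.appTop r
  rw [show (homOfLE (le_top : (⊤ : X.Opens) ≤ ⊤)) = 𝟙 _ from Subsingleton.elim _ _, op_id, X.presheaf.map_id]
  rfl

/-- `f` lies in the prime `B.toSpecΓ b` of `Spec Γ(B, 𝒪)` iff `b ∉ D(f)` (Mathlib `Scheme.toSpecΓ_preimage_basicOpen`).
[cite: EGAIII2, 7.7.5 (I)] -/
theorem mem_asIdeal_toSpecΓ_iff (b : B) (f : Γ(B, ⊤)) : f ∈ (B.toSpecΓ.base b).asIdeal ↔ b ∉ B.basicOpen f := by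
  have h : b ∈ B.toSpecΓ ⁻¹ᵁ PrimeSpectrum.basicOpen f ↔ b ∈ B.basicOpen f := by
    rw [Scheme.toSpecΓ_preimage_basicOpen]
  have h' : b ∈ B.toSpecΓ ⁻¹ᵁ PrimeSpectrum.basicOpen f ↔ f ∉ (B.toSpecΓ.base b).asIdeal :=
    PrimeSpectrum.mem_basicOpen _ (x := B.toSpecΓ.base b)
  tauto

/-- **The kernel of `Γ(B, 𝒪) → Γ(Spec K, 𝒪)` along a field point `y` is the prime `B.toSpecΓ (y pt)`** (in the `appLE ⊤ ⊤`
form used as algebra structure by ★ `Modules/ProperFlatH0KernelRepr`). [cite: EGAIII2, 7.7.5 (I)] -/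
theorem ker_fieldPoint_eq_asIdeal_toSpecΓ (pt : Spec (.of K)) :
    RingHom.ker (y.appLE ⊤ ⊤ le_top).hom = (B.toSpecΓ.base (y.base pt)).asIdeal := by
  ext f
  rw [RingHom.mem_ker, appLE_top_top_apply, mem_asIdeal_toSpecΓ_iff, appTop_fieldPoint_eq_zero_iff B y pt]

end Points

/-! ## §3 `h⁰` along a field point is the kernel fibre rank at the image prime -/

section FibreRank

variable {X B : Scheme.{0}} (g : X ⟶ B) (G : X.Modules)
  {K0 K1 : ModuleCat.{0} Γ(B, ⊤)} (d : K0 ⟶ K1)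
  [Module.Finite Γ(B, ⊤) K0] [Projective Γ(B, ⊤) K0] [Module.Finite Γ(B, ⊤) K1] [Projective Γ(B, ⊤) K1]
  (hd : ∀ ⦃X' B' : Scheme.{0}⦄ (k : X' ⟶ X) (g' : X' ⟶ B') (j : B' ⟶ B) [IsAffine B'], IsPullback k g' g j →
    letI := (j.appLE ⊤ ⊤ le_top).hom.toAlgebra
    Nonempty (SecMod ((Scheme.Modules.pullback k).obj G) g'.appTop.hom ⊤ ≃ₗ[Γ(B', ⊤)]
      LinearMap.ker (d.hom.baseChange Γ(B', ⊤))))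

include hd in
/-- **`h⁰(y) = dim_{κ(𝔮)} ker(d ⊗ κ(𝔮))`**: for a two-term complex `d : K⁰ → K¹` computing `H⁰(·, G)` universally (hypothesis
`hd` = the conclusion of ★ `Modules.exists_twoTerm_ker_repr`), a field point `y : Spec K → B` over `b ∈ B` and a cartesian
square `Z = X ×_B Spec K`, the rank of `Γ(Z, fst^*G)` over `Γ(Spec K, 𝒪)` equals the fibre rank of `ker d` at the prime
`𝔮 = B.toSpecΓ b` (the representation at the test object `Spec K`, then §1 along `Γ(B, 𝒪) → κ(𝔮) → Γ(Spec K, 𝒪)`).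
[cite: MumfordAV1970, §5 Cor. 2 (p. 50)] [cite: EGAIII2, 7.7.6] -/
theorem finrank_secMod_fieldPoint_eq_finrank_ker {K : Type} [Field K] (y : Spec (.of K) ⟶ B) (pt : Spec (.of K))
    (b : B) (hb : y.base pt = b) {Z : Scheme.{0}} (fst : Z ⟶ X) (snd : Z ⟶ Spec (.of K)) (H : IsPullback fst snd g y) :
    finrank Γ(Spec (.of K), ⊤) (SecMod ((Scheme.Modules.pullback fst).obj G) snd.appTop.hom ⊤) =
      finrank (B.toSpecΓ.base b).asIdeal.ResidueField
        (LinearMap.ker (d.hom.baseChange (B.toSpecΓ.base b).asIdeal.ResidueField)) := by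
  subst hb
  -- the test ring `Γ(Spec K, 𝒪) ≅ K` is a field and a `Γ(B, 𝒪)`-algebra through `y`
  letI hF : Field Γ(Spec (.of K), ⊤) :=
    ((Scheme.ΓSpecIso (.of K)).commRingCatIsoToRingEquiv.toMulEquiv.isField (Field.toIsField K)).toField
  letI : Algebra Γ(B, ⊤) Γ(Spec (.of K), ⊤) := (y.appLE ⊤ ⊤ le_top).hom.toAlgebra
  obtain ⟨θ⟩ := hd fst snd y H
  rw [θ.finrank_eq]
  -- the tower `Γ(B, 𝒪) → κ(𝔮) → Γ(Spec K, 𝒪)`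
  have hker : (B.toSpecΓ.base (y.base pt)).asIdeal ≤ RingHom.ker (algebraMap Γ(B, ⊤) Γ(Spec (.of K), ⊤)) :=
    (ker_fieldPoint_eq_asIdeal_toSpecΓ B y pt).symm.le
  have hunit : (B.toSpecΓ.base (y.base pt)).asIdeal.primeCompl ≤ (IsUnit.submonoid Γ(Spec (.of K), ⊤)).comap
      (algebraMap Γ(B, ⊤) Γ(Spec (.of K), ⊤)) := by
    intro a ha
    have hne : algebraMap Γ(B, ⊤) Γ(Spec (.of K), ⊤) a ≠ 0 := fun h0 =>
      ha ((ker_fieldPoint_eq_asIdeal_toSpecΓ B y pt).le h0)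
    exact isUnit_iff_ne_zero.mpr hne
  letI : Algebra (B.toSpecΓ.base (y.base pt)).asIdeal.ResidueField Γ(Spec (.of K), ⊤) :=
    (Ideal.ResidueField.lift _ (algebraMap Γ(B, ⊤) Γ(Spec (.of K), ⊤)) hker hunit).toAlgebra
  haveI : IsScalarTower Γ(B, ⊤) (B.toSpecΓ.base (y.base pt)).asIdeal.ResidueField Γ(Spec (.of K), ⊤) :=
    IsScalarTower.of_algebraMap_eq fun a => (Ideal.ResidueField.lift_algebraMap _ _ hker hunit a).symm
  exact finrank_ker_baseChange_eq_of_isScalarTower d.hom _ Γ(Spec (.of K), ⊤)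

include hd in
/-- `h⁰` along a field point depends only on the image point of `B`. [cite: MumfordAV1970, §5 Cor. 2 (p. 50)] -/
theorem finrank_secMod_fieldPoint_eq_of_base_eq {K K' : Type} [Field K] [Field K'] (y : Spec (.of K) ⟶ B)
    (y' : Spec (.of K') ⟶ B) (pt : Spec (.of K)) (pt' : Spec (.of K')) (hb : y.base pt = y'.base pt')
    {Z Z' : Scheme.{0}} (fst : Z ⟶ X) (snd : Z ⟶ Spec (.of K)) (H : IsPullback fst snd g y)
    (fst' : Z' ⟶ X) (snd' : Z' ⟶ Spec (.of K')) (H' : IsPullback fst' snd' g y') :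
    finrank Γ(Spec (.of K), ⊤) (SecMod ((Scheme.Modules.pullback fst).obj G) snd.appTop.hom ⊤) =
      finrank Γ(Spec (.of K'), ⊤) (SecMod ((Scheme.Modules.pullback fst').obj G) snd'.appTop.hom ⊤) := by
  rw [finrank_secMod_fieldPoint_eq_finrank_ker g G d hd y pt _ hb fst snd H,
    finrank_secMod_fieldPoint_eq_finrank_ker g G d hd y' pt' _ rfl fst' snd' H']

end FibreRank

/-! ## §4 Upper semicontinuity -/

section Semicontinuity

variable {X B : Scheme.{0}} (g : X ⟶ B) [IsAffine B] [IsProper g] [Flat g] [IsLocallyNoetherian B]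
  (G : X.Modules) (hL : IsFiniteLocallyFree G)

include hL in
/-- **UPPER SEMICONTINUITY OF `h⁰` (closed form, field points)**: for `g : X → B` proper and flat over an affine locally
noetherian `B` and `G` finite locally free, the set of `b ∈ B` such that `n ≤ dim Γ(X ×_B Spec K, G)` for every field
point `Spec K → B` hitting `b` (and every cartesian square) is CLOSED — the preimage under the continuous
`B.toSpecΓ : B → Spec Γ(B, 𝒪)` of `{𝔮 | n ≤ dim ker(d ⊗ κ(𝔮))}`, closed by ★ `isClosed_setOf_le_finrank_ker_baseChange`.
[cite: MumfordAV1970, §5 Cor. 1 (p. 50)] [cite: EGAIII2, 7.7.5 (I)] [cite: GortzWedhorn2023, Thm. 23.139 (2)] -/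
theorem isClosed_setOf_le_finrank_secMod_fieldPoint (n : ℕ) :
    IsClosed {b : B | ∀ ⦃K : Type⦄ [Field K] (y : Spec (.of K) ⟶ B) (pt : Spec (.of K)), y.base pt = b →
      ∀ ⦃Z : Scheme.{0}⦄ (fst : Z ⟶ X) (snd : Z ⟶ Spec (.of K)), IsPullback fst snd g y →
        n ≤ finrank Γ(Spec (.of K), ⊤) (SecMod ((Scheme.Modules.pullback fst).obj G) snd.appTop.hom ⊤)} := by
  obtain ⟨K0, K1, d, ⟨hf0, hp0, hf1, hp1⟩, hd⟩ := exists_twoTerm_ker_repr g G hL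
  let C : Set (Spec Γ(B, ⊤)) := {q | n ≤ finrank q.asIdeal.ResidueField
    (LinearMap.ker (d.hom.baseChange q.asIdeal.ResidueField))}
  have hC : IsClosed C := isClosed_setOf_le_finrank_ker_baseChange d.hom n
  have key : ∀ b : B, (∀ ⦃K : Type⦄ [Field K] (y : Spec (.of K) ⟶ B) (pt : Spec (.of K)), y.base pt = b →
      ∀ ⦃Z : Scheme.{0}⦄ (fst : Z ⟶ X) (snd : Z ⟶ Spec (.of K)), IsPullback fst snd g y →
        n ≤ finrank Γ(Spec (.of K), ⊤) (SecMod ((Scheme.Modules.pullback fst).obj G) snd.appTop.hom ⊤)) ↔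
      n ≤ finrank (B.toSpecΓ.base b).asIdeal.ResidueField
        (LinearMap.ker (d.hom.baseChange (B.toSpecΓ.base b).asIdeal.ResidueField)) := fun b => by
    refine ⟨fun h => ?_, fun h K _ y pt hpt Z fst snd H => ?_⟩
    · let pt₀ : Spec (B.residueField b) := IsLocalRing.closedPoint (B.residueField b)
      have hb₀ : (B.fromSpecResidueField b).base pt₀ = b := Scheme.fromSpecResidueField_apply b pt₀
      rw [← finrank_secMod_fieldPoint_eq_finrank_ker g G d hd (B.fromSpecResidueField b) pt₀ b hb₀ _ _
        (IsPullback.of_hasPullback g (B.fromSpecResidueField b))]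
      exact h _ pt₀ hb₀ _ _ (IsPullback.of_hasPullback g (B.fromSpecResidueField b))
    · rw [finrank_secMod_fieldPoint_eq_finrank_ker g G d hd y pt b hpt fst snd H]
      exact h
  have hset : {b : B | ∀ ⦃K : Type⦄ [Field K] (y : Spec (.of K) ⟶ B) (pt : Spec (.of K)), y.base pt = b →
      ∀ ⦃Z : Scheme.{0}⦄ (fst : Z ⟶ X) (snd : Z ⟶ Spec (.of K)), IsPullback fst snd g y →
        n ≤ finrank Γ(Spec (.of K), ⊤) (SecMod ((Scheme.Modules.pullback fst).obj G) snd.appTop.hom ⊤)} =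
      B.toSpecΓ.base ⁻¹' C := Set.ext key
  rw [hset]
  exact hC.preimage B.toSpecΓ.base.hom.continuous

include hL in
/-- **UPPER SEMICONTINUITY OF `h⁰` (open form)**: `{b | h⁰ < n}` is OPEN, `h⁰` read on every field point over `b` and every
cartesian square. [cite: MumfordAV1970, §5 Cor. 1 (p. 50)] [cite: EGAIII2, 7.7.5 (I)] [cite: Hartshorne1977, III Thm. 12.8 (p. 288)] -/
theorem isOpen_setOf_finrank_secMod_fieldPoint_lt (n : ℕ) :
    IsOpen {b : B | ∀ ⦃K : Type⦄ [Field K] (y : Spec (.of K) ⟶ B) (pt : Spec (.of K)), y.base pt = b →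
      ∀ ⦃Z : Scheme.{0}⦄ (fst : Z ⟶ X) (snd : Z ⟶ Spec (.of K)), IsPullback fst snd g y →
        finrank Γ(Spec (.of K), ⊤) (SecMod ((Scheme.Modules.pullback fst).obj G) snd.appTop.hom ⊤) < n} := by
  obtain ⟨K0, K1, d, ⟨hf0, hp0, hf1, hp1⟩, hd⟩ := exists_twoTerm_ker_repr g G hL
  let C : Set (Spec Γ(B, ⊤)) := {q | finrank q.asIdeal.ResidueField
    (LinearMap.ker (d.hom.baseChange q.asIdeal.ResidueField)) < n}
  have hC : IsOpen C := isOpen_setOf_finrank_ker_baseChange_lt d.hom n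
  have key : ∀ b : B, (∀ ⦃K : Type⦄ [Field K] (y : Spec (.of K) ⟶ B) (pt : Spec (.of K)), y.base pt = b →
      ∀ ⦃Z : Scheme.{0}⦄ (fst : Z ⟶ X) (snd : Z ⟶ Spec (.of K)), IsPullback fst snd g y →
        finrank Γ(Spec (.of K), ⊤) (SecMod ((Scheme.Modules.pullback fst).obj G) snd.appTop.hom ⊤) < n) ↔
      finrank (B.toSpecΓ.base b).asIdeal.ResidueField
        (LinearMap.ker (d.hom.baseChange (B.toSpecΓ.base b).asIdeal.ResidueField)) < n := fun b => by
    refine ⟨fun h => ?_, fun h K _ y pt hpt Z fst snd H => ?_⟩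
    · let pt₀ : Spec (B.residueField b) := IsLocalRing.closedPoint (B.residueField b)
      have hb₀ : (B.fromSpecResidueField b).base pt₀ = b := Scheme.fromSpecResidueField_apply b pt₀
      rw [← finrank_secMod_fieldPoint_eq_finrank_ker g G d hd (B.fromSpecResidueField b) pt₀ b hb₀ _ _
        (IsPullback.of_hasPullback g (B.fromSpecResidueField b))]
      exact h _ pt₀ hb₀ _ _ (IsPullback.of_hasPullback g (B.fromSpecResidueField b))
    · rw [finrank_secMod_fieldPoint_eq_finrank_ker g G d hd y pt b hpt fst snd H]
      exact h
  have hset : {b : B | ∀ ⦃K : Type⦄ [Field K] (y : Spec (.of K) ⟶ B) (pt : Spec (.of K)), y.base pt = b →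
      ∀ ⦃Z : Scheme.{0}⦄ (fst : Z ⟶ X) (snd : Z ⟶ Spec (.of K)), IsPullback fst snd g y →
        finrank Γ(Spec (.of K), ⊤) (SecMod ((Scheme.Modules.pullback fst).obj G) snd.appTop.hom ⊤) < n} =
      B.toSpecΓ.base ⁻¹' C := Set.ext key
  rw [hset]
  exact hC.preimage B.toSpecΓ.base.hom.continuous

include hL in
/-- **UPPER SEMICONTINUITY OF `h⁰` ON MATHLIB FIBRES (closed form)**: `{b | n ≤ dim Γ(g.fiber b, G|)}` is closed, the sections
of `G` on the fibre `g.fiber b = X ×_B Spec κ(b)` being a module over `Γ(Spec κ(b), 𝒪) ≅ κ(b)` through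
`g.fiberToSpecResidueField b`. [cite: MumfordAV1970, §5 Cor. 1 (p. 50)] [cite: EGAIII2, 7.7.5 (I)]
[cite: GortzWedhorn2023, Thm. 23.139 (2)] -/
theorem isClosed_setOf_le_finrank_secMod_fiber (n : ℕ) :
    IsClosed {b : B | n ≤ finrank Γ(Spec (B.residueField b), ⊤)
      (SecMod ((Scheme.Modules.pullback (g.fiberι b)).obj G) (g.fiberToSpecResidueField b).appTop.hom ⊤)} := by
  obtain ⟨K0, K1, d, ⟨hf0, hp0, hf1, hp1⟩, hd⟩ := exists_twoTerm_ker_repr g G hL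
  let C : Set (Spec Γ(B, ⊤)) := {q | n ≤ finrank q.asIdeal.ResidueField
    (LinearMap.ker (d.hom.baseChange q.asIdeal.ResidueField))}
  have hC : IsClosed C := isClosed_setOf_le_finrank_ker_baseChange d.hom n
  have key : ∀ b : B, n ≤ finrank Γ(Spec (B.residueField b), ⊤)
      (SecMod ((Scheme.Modules.pullback (g.fiberι b)).obj G) (g.fiberToSpecResidueField b).appTop.hom ⊤) ↔
      n ≤ finrank (B.toSpecΓ.base b).asIdeal.ResidueField
        (LinearMap.ker (d.hom.baseChange (B.toSpecΓ.base b).asIdeal.ResidueField)) := fun b => by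
    have e := finrank_secMod_fieldPoint_eq_finrank_ker g G d hd (B.fromSpecResidueField b)
      (IsLocalRing.closedPoint (B.residueField b)) b (Scheme.fromSpecResidueField_apply b _) (g.fiberι b)
      (g.fiberToSpecResidueField b) (IsPullback.of_hasPullback g (B.fromSpecResidueField b))
    rw [← e]
    exact Iff.rfl
  have hset : {b : B | n ≤ finrank Γ(Spec (B.residueField b), ⊤)
      (SecMod ((Scheme.Modules.pullback (g.fiberι b)).obj G) (g.fiberToSpecResidueField b).appTop.hom ⊤)} =
      B.toSpecΓ.base ⁻¹' C := Set.ext key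
  rw [hset]
  exact hC.preimage B.toSpecΓ.base.hom.continuous

include hL in
/-- **UPPER SEMICONTINUITY OF `h⁰` ON MATHLIB FIBRES (open form)**: `{b | dim Γ(g.fiber b, G|) < n}` is open.
[cite: MumfordAV1970, §5 Cor. 1 (p. 50)] [cite: EGAIII2, 7.7.5 (I)] [cite: Hartshorne1977, III Thm. 12.8 (p. 288)] -/
theorem isOpen_setOf_finrank_secMod_fiber_lt (n : ℕ) :
    IsOpen {b : B | finrank Γ(Spec (B.residueField b), ⊤)
      (SecMod ((Scheme.Modules.pullback (g.fiberι b)).obj G) (g.fiberToSpecResidueField b).appTop.hom ⊤) < n} := by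
  obtain ⟨K0, K1, d, ⟨hf0, hp0, hf1, hp1⟩, hd⟩ := exists_twoTerm_ker_repr g G hL
  let C : Set (Spec Γ(B, ⊤)) := {q | finrank q.asIdeal.ResidueField
    (LinearMap.ker (d.hom.baseChange q.asIdeal.ResidueField)) < n}
  have hC : IsOpen C := isOpen_setOf_finrank_ker_baseChange_lt d.hom n
  have key : ∀ b : B, finrank Γ(Spec (B.residueField b), ⊤)
      (SecMod ((Scheme.Modules.pullback (g.fiberι b)).obj G) (g.fiberToSpecResidueField b).appTop.hom ⊤) < n ↔
      finrank (B.toSpecΓ.base b).asIdeal.ResidueField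
        (LinearMap.ker (d.hom.baseChange (B.toSpecΓ.base b).asIdeal.ResidueField)) < n := fun b => by
    have e := finrank_secMod_fieldPoint_eq_finrank_ker g G d hd (B.fromSpecResidueField b)
      (IsLocalRing.closedPoint (B.residueField b)) b (Scheme.fromSpecResidueField_apply b _) (g.fiberι b)
      (g.fiberToSpecResidueField b) (IsPullback.of_hasPullback g (B.fromSpecResidueField b))
    rw [← e]
    exact Iff.rfl
  have hset : {b : B | finrank Γ(Spec (B.residueField b), ⊤)
      (SecMod ((Scheme.Modules.pullback (g.fiberι b)).obj G) (g.fiberToSpecResidueField b).appTop.hom ⊤) < n} =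
      B.toSpecΓ.base ⁻¹' C := Set.ext key
  rw [hset]
  exact hC.preimage B.toSpecΓ.base.hom.continuous

include hL in
/-- `h⁰` on the Mathlib fibre equals `h⁰` along any field point over the same `b` (any cartesian square).
[cite: MumfordAV1970, §5 Cor. 2 (p. 50)] -/
theorem finrank_secMod_fieldPoint_eq_finrank_secMod_fiber {K : Type} [Field K] (y : Spec (.of K) ⟶ B)
    (pt : Spec (.of K)) (b : B) (hb : y.base pt = b) {Z : Scheme.{0}} (fst : Z ⟶ X) (snd : Z ⟶ Spec (.of K))
    (H : IsPullback fst snd g y) :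
    finrank Γ(Spec (.of K), ⊤) (SecMod ((Scheme.Modules.pullback fst).obj G) snd.appTop.hom ⊤) =
      finrank Γ(Spec (B.residueField b), ⊤)
        (SecMod ((Scheme.Modules.pullback (g.fiberι b)).obj G) (g.fiberToSpecResidueField b).appTop.hom ⊤) := by
  obtain ⟨K0, K1, d, ⟨hf0, hp0, hf1, hp1⟩, hd⟩ := exists_twoTerm_ker_repr g G hL
  rw [finrank_secMod_fieldPoint_eq_finrank_ker g G d hd y pt b hb fst snd H]
  exact (finrank_secMod_fieldPoint_eq_finrank_ker g G d hd (B.fromSpecResidueField b)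
    (IsLocalRing.closedPoint (B.residueField b)) b (Scheme.fromSpecResidueField_apply b _) (g.fiberι b)
    (g.fiberToSpecResidueField b) (IsPullback.of_hasPullback g (B.fromSpecResidueField b))).symm

end Semicontinuity

end Literature.AlgebraicGeometry.Morphisms

end
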